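import Literature.NumberTheory.EllipticCurves.KernelReductionInertiaProofs
import HarnessLib

/-!
# The kernel of reduction as a common receptacle for `(τ - 1) E[ℓᵐ]`, `τ` inertial
(route `SkinnerWilesDefectOne`, item stmt-Langlands-12922 `FiveIsogenyEllipticCurves`, helper)

J.-P. Serre, *Abelian ℓ-adic representations and elliptic curves* (1968), IV, A.2.2: at a place
`v ∣ ℓ` of good ordinary reduction the kernel of reduction `X = T_ℓ(Ê)` is a line, stable under the
decomposition group, and inertia acts trivially on `T_ℓ E / X`.  The tree proves the finite-level
shadow ONE INERTIA ELEMENT AT A TIME (`WeierstrassCurve.card_map_smul_sub_geomTorsion_le_pow`: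
`#((τ - 1) E[ℓᵐ]) ≤ ℓᵐ`).  For the ordinary filtration of the whole inertia group the headline
corollary needs the JOINT statement proved here (`exists_receptacle`): for every `m` there is one
subgroup `X ≤ E[ℓᵐ]` with `#X ≤ ℓᵐ` containing `P^τ - P` for EVERY `τ` in the inertia group
`I_𝔓` and every `P ∈ E[ℓᵐ]` — namely `E[ℓᵐ] ∩ E₁`, the `ℓᵐ`-torsion of the kernel of reduction,
transported along one embedding `K̄ → K̄_v` cutting out `𝔓` (`exists_map_forall_smul_sub_mem`,
the tree's `exists_map_smul_sub_reducesToZero` with the quantifier over `τ` moved inside) and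
bounded by the tree's `card_addSubgroup_le_pow_of_hasseCoeff` (Silverman V.3.1(a)/VII.2 via the
Hasse invariant).  That `E₁ ∪ {O}` is a subgroup (Silverman, *AEC*, VII.2.1–2.2) is re-proved on
the spot from the valuation estimates of `GoodReductionInertia` (`exists_kernelSubgroup`).

References: J.-P. Serre (1968), IV A.2.2; J. H. Silverman, *The Arithmetic of Elliptic Curves*
(2009), Prop. VII.2.1, VII.2.2, VII.3.1; J. Neukirch, *Algebraic Number Theory* (1999), II (9.6).
-/

noncomputable section

-- `Summit.Langlands.Langlands.…`: summit = sub-problem name (D-0017 layout), as in every Theorems file here.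
set_option linter.dupNamespace false

open scoped Classical NNReal NumberField Pointwise
open NumberField IsDedekindDomain Field
open Literature.NumberTheory.EllipticCurves Literature.NumberTheory.GaloisRepresentations
open IsDedekindDomain.HeightOneSpectrum WeierstrassCurve

namespace Summit.Langlands.Langlands.Theorems.FiveIsogenyEllipticCurves

universe u

/-! ### `E₁ ∪ {O}` is a subgroup (valued fields) -/

section Kernel

variable {L : Type u} [Field L] (w : Valuation L ℝ≥0) (V : WeierstrassCurve L)
  [hV : V.IsIntegral w.integer]

/-- **The kernel of reduction is a subgroup** (Silverman, *AEC*, VII.2.1–2.2): on a `w`-integral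
Weierstrass equation, the set of points which are `O` or affine with `x`-coordinate of valuation
`> 1` is (the carrier of) a subgroup — closed under negation (same `x`) and addition: if
`P, Q ∈ E₁` had an integral sum `P + Q = T`, then `Q = (-P) + T` would have integral
`x`-coordinate (`val_addX_le_one_of_one_lt`: a point of `E₁` plus an integral point is integral).
Stated as the existence of an `AddSubgroup` with this carrier (no definition is introduced).
[cite: SilvermanAEC2009, Prop. VII.2.1] -/
theorem exists_kernelSubgroup :
    ∃ S : AddSubgroup V.toAffine.Point, ∀ P, P ∈ S ↔ ∀ x y h, P = .some x y h → 1 < w x := by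
  refine ⟨{ carrier := {P | ∀ x y h, P = .some x y h → 1 < w x}
            zero_mem' := fun x y h h0 => by cases h0
            neg_mem' := ?_
            add_mem' := ?_ }, fun P => Iff.rfl⟩
  · intro P Q hP hQ x₃ y₃ h₃ hsum
    rcases P with _ | ⟨x₁, y₁, h₁⟩
    · rw [← Affine.Point.zero_def, zero_add] at hsum
      exact hQ x₃ y₃ h₃ hsum
    rcases Q with _ | ⟨x₂, y₂, h₂⟩
    · rw [← Affine.Point.zero_def, add_zero] at hsum
      exact hP x₃ y₃ h₃ hsum
    have hx₁ : 1 < w x₁ := hP x₁ y₁ h₁ rfl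
    have hx₂ : 1 < w x₂ := hQ x₂ y₂ h₂ rfl
    by_contra hx₃
    rw [not_lt] at hx₃
    have hy₃ : w y₃ ≤ 1 := val_y_le_one h₃.1 hx₃
    -- `Q = (-P) + (P + Q)` has integral `x`-coordinate: contradiction
    have hneg : V.toAffine.Equation x₁ (V.toAffine.negY x₁ y₁) :=
      ((Affine.nonsingular_neg x₁ y₁).mpr h₁).1
    obtain ⟨hne, hint⟩ := val_addX_le_one_of_one_lt (V := V) (w := w) hneg hx₁ hx₃ hy₃
    have hQeq : Affine.Point.some x₂ y₂ h₂ =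
        -Affine.Point.some x₁ y₁ h₁ + Affine.Point.some x₃ y₃ h₃ := by
      rw [← hsum, neg_add_cancel_left]
    rw [Affine.Point.neg_some, Affine.Point.add_of_X_ne hne] at hQeq
    cases hQeq
    exact absurd hint (not_le.mpr hx₂)
  · intro P hP
    rcases P with _ | ⟨x', y', h'⟩
    · intro x y h h0
      rw [← Affine.Point.zero_def, neg_zero] at h0
      exact absurd h0.symm (Affine.Point.some_ne_zero h)
    · intro x y h hneg
      rw [Affine.Point.neg_some] at hneg
      cases hneg
      exact hP x' y' h' rfl

end Kernel

/-! ### Number fields: one embedding `K̄ → K̄_v` for the whole inertia group -/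

section NumberField

variable {K : Type u} [Field K] [NumberField K] (W : WeierstrassCurve K)

/-- **All of `I_𝔓` moves geometric points into the kernel of reduction, along ONE embedding.**
Let `E/K` be elliptic over a number field, `v` a finite place with a good model `M/𝓞_v`
(`C • E_{K_v} = M_{K_v}`, `Δ(M) ∈ 𝓞_vˣ`) and `𝔓 ∣ v` a prime of `\bar ℤ_K`.  Then there are the
spectral valuation `w` of `K̄_v` and an injective additive `Ψ : E(K̄) → M(K̄_v)` such that
`M_{K̄_v}` is `w`-integral and, for EVERY `τ` in the inertia group `I_𝔓` and every `P ∈ E(K̄)`,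
the point `Ψ(P^τ - P)`, if affine, has `x`-coordinate of valuation `> 1`.  This is the tree's
`WeierstrassCurve.exists_map_smul_sub_reducesToZero` (Silverman VII.2.1 glued with Neukirch II
(9.6)) with the quantifier over `τ` moved inside: the embedding `ι : K̄ → K̄_v` cutting out `𝔓`
is chosen once, and each `τ ∈ I_𝔓` is then lifted to the local inertia group
(`exists_mem_inertia_apply_eq_holds`).
[cite: SilvermanAEC2009, Prop. VII.2.1] [cite: NeukirchANT1999, Ch. II §9 Prop. (9.6)] -/
theorem exists_map_forall_smul_sub [W.IsElliptic] {v : HeightOneSpectrum (𝓞 K)}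
    {C : VariableChange (v.adicCompletion K)} {M : WeierstrassCurve (v.adicCompletionIntegers K)}
    (hCM : C • W.baseChange (v.adicCompletion K) =
      M.map (algebraMap (v.adicCompletionIntegers K) (v.adicCompletion K)))
    {𝔓 : Ideal (absIntegers (𝓞 K) K)} (h𝔓 : 𝔓 ∈ v.primesAbove) :
    ∃ (w : Valuation (AlgebraicClosure (v.adicCompletion K)) ℝ≥0)
      (_ : ∀ x, (w x : ℝ) =
        spectralNorm (v.adicCompletion K) (AlgebraicClosure (v.adicCompletion K)) x)
      (_ : ((M.map (algebraMap (v.adicCompletionIntegers K) (v.adicCompletion K))).baseChange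
        (AlgebraicClosure (v.adicCompletion K))).IsIntegral w.integer)
      (Ψ : geomPoints W →+ ((M.map (algebraMap (v.adicCompletionIntegers K)
        (v.adicCompletion K))).baseChange (AlgebraicClosure (v.adicCompletion K))).toAffine.Point),
      Function.Injective Ψ ∧
        ∀ τ ∈ 𝔓.inertia (absoluteGaloisGroup K), IsUnit M.Δ →
          ∀ (P : geomPoints W) (s t : AlgebraicClosure (v.adicCompletion K)) h,
            Ψ (τ • P - P) = .some s t h → 1 < w s := by
  obtain ⟨𝔐, h𝔐⟩ := v.localPrimesAbove_nonempty
  -- arrange `𝔓 = 𝔓_{ι,𝔐}` for an embedding `ι : K̄ → K̄_v`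
  obtain ⟨g, hg⟩ := HeightOneSpectrum.exists_smul_eq_of_mem_primesAbove_holds
    (HeightOneSpectrum.primeBelow_mem_primesAbove
      (ι := closureEmb (K := K) (v.adicCompletion K)) h𝔐) h𝔓
  set ι : AlgebraicClosure K →ₐ[K] AlgebraicClosure (v.adicCompletion K) :=
    (closureEmb (K := K) (v.adicCompletion K)).comp
      ((show AlgebraicClosure K ≃ₐ[K] AlgebraicClosure K from g⁻¹) :
        AlgebraicClosure K →ₐ[K] AlgebraicClosure K) with hι
  have h1 : 𝔓 = v.primeBelow ι 𝔐 := by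
    rw [hι, HeightOneSpectrum.primeBelow_comp, ← hg]
    exact congrArg (· • _) (inv_inv g).symm
  obtain ⟨w, hw⟩ := v.exists_spectralValuation
  -- notation: `E = K_v`, `L = K̄_v`
  set E := v.adicCompletion K
  set L := AlgebraicClosure (v.adicCompletion K)
  haveI hint := isIntegral_spectralValuation_baseChange hw M
  -- transport to the good model, equivariantly
  have hCM' := congrArg (fun X : WeierstrassCurve E ↦ X.baseChange L) hCM
  let Φ : localPoints W E ≃+
      ((M.map (algebraMap (v.adicCompletionIntegers K) E)).baseChange L).toAffine.Point :=
    ((Affine.Point.congrEquiv (baseChange_baseChange_adicCompletion W v).symm).trans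
      (VariableChange.pointEquivBaseChange (W.baseChange E) C L)).trans
      (Affine.Point.congrEquiv hCM')
  have hΦ : ∀ (σ : absoluteGaloisGroup E) (Q : localPoints W E),
      Φ (σ • Q) = Affine.Point.map (absoluteGaloisGroup.toAlgEquiv _ σ : L →ₐ[E] L) (Φ Q) := by
    intro σ Q
    change Affine.Point.congrEquiv hCM' (VariableChange.pointEquivBaseChange (W.baseChange E) C L
        (Affine.Point.congrEquiv (baseChange_baseChange_adicCompletion W v).symm (σ • Q))) =
      Affine.Point.map (absoluteGaloisGroup.toAlgEquiv _ σ : L →ₐ[E] L) (Affine.Point.congrEquiv hCM'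
        (VariableChange.pointEquivBaseChange (W.baseChange E) C L
          (Affine.Point.congrEquiv (baseChange_baseChange_adicCompletion W v).symm Q)))
    rw [congrEquiv_smul, VariableChange.pointEquivBaseChange_map_algEquiv]
    exact Affine.Point.congrEquiv_baseChange_map hCM _ _
  refine ⟨w, hw, hint, Φ.toAddMonoidHom.comp (pointsMapOfEmb W ι),
    Φ.injective.comp (pointsMapOfEmb_injective W ι), fun τ hτ hΔ P s t h hP ↦ ?_⟩
  -- lift `τ ∈ I_𝔓` to the local inertia group `I_𝔐 ≤ Γ_{K_v}` (Neukirch II (9.6))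
  rw [h1] at hτ
  obtain ⟨σ, hσI, hσ⟩ :=
    IsDedekindDomain.HeightOneSpectrum.exists_mem_inertia_apply_eq_holds v ι h𝔐 hτ
  have hres : resGalOfEmb ι σ = τ := resGalOfEmb_eq_of_apply_eq ι hσ
  set σE : L ≃ₐ[E] L := absoluteGaloisGroup.toAlgEquiv _ σ with hσE
  have hσ₁ : ∀ z : L, w (σE z) = w z := fun z ↦ spectralValuation_smul hw σ z
  have hσ₂ : ∀ z : L, w z ≤ 1 → w (σE z - z) < 1 :=
    (mem_inertia_iff_spectralValuation hw h𝔐).mp hσI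
  have hequiv : pointsMapOfEmb W ι (τ • P) = σ • pointsMapOfEmb W ι P := by
    rw [← hres]
    exact pointsMapOfEmb_smul W ι σ P
  have hΔw := spectralValuation_Δ_baseChange hw hΔ
  rw [AddMonoidHom.coe_comp, Function.comp_apply, map_sub, hequiv, AddEquiv.coe_toAddMonoidHom,
    map_sub, hΦ] at hP
  exact one_lt_valuation_of_map_sub_eq_some (w := w) _ hΔw σE hσ₁ hσ₂ _ hP

/-- **The common receptacle `E[ℓᵐ] ∩ E₁` at a place of good ordinary reduction above `ℓ`**
(Serre 1968, IV A.2.2, all of inertia at once).  Let `E/K` be elliptic over a number field, `ℓ`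
an odd prime, `v ∣ ℓ` with a good ORDINARY model `M/𝓞_v` (`C • E_{K_v} = M_{K_v}`, `Δ(M)` and the
Hasse invariant `A_ℓ(M)` units of `𝓞_v`), `𝔓 ∣ v`.  Then for every `m` there is a subgroup
`X ≤ E[ℓᵐ] = E(K̄)[ℓᵐ]` with at most `ℓᵐ` elements which contains `P^τ - P` for every `τ` in the
inertia group `I_𝔓` and every `P ∈ E[ℓᵐ]`: the points of `E[ℓᵐ]` mapping into the kernel of
reduction along the embedding of `exists_map_forall_smul_sub`, bounded by the tree's
`card_addSubgroup_le_pow_of_hasseCoeff` (Silverman V.3.1(a): `#Ê[ℓᵐ] ≤ ℓᵐ` via the Hasse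
invariant). [cite: SerreAbelianLadic1968, IV A.2.2] -/
theorem exists_receptacle [W.IsElliptic] {v : HeightOneSpectrum (𝓞 K)} {ℓ : ℕ} [hℓ : Fact ℓ.Prime]
    (hℓ2 : ℓ ≠ 2) (hℓv : (ℓ : 𝓞 K) ∈ v.asIdeal)
    {C : VariableChange (v.adicCompletion K)} {M : WeierstrassCurve (v.adicCompletionIntegers K)}
    (hCM : C • W.baseChange (v.adicCompletion K) =
      M.map (algebraMap (v.adicCompletionIntegers K) (v.adicCompletion K))) (hΔ : IsUnit M.Δ)
    (hA : IsUnit (M.hasseCoeff ℓ))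
    {𝔓 : Ideal (absIntegers (𝓞 K) K)} (h𝔓 : 𝔓 ∈ v.primesAbove) (m : ℕ) :
    ∃ X : AddSubgroup (geomPoints W), X ≤ geomTorsion W ((ℓ ^ m : ℕ) : ℤ) ∧ Nat.card X ≤ ℓ ^ m ∧
      ∀ τ ∈ 𝔓.inertia (absoluteGaloisGroup K), ∀ P ∈ geomTorsion W ((ℓ ^ m : ℕ) : ℤ),
        τ • P - P ∈ X := by
  obtain ⟨w, hw, hint, Ψ, hΨinj, hΨ⟩ := exists_map_forall_smul_sub W hCM h𝔓
  haveI := hint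
  obtain ⟨S, hS⟩ := exists_kernelSubgroup w ((M.map (algebraMap (v.adicCompletionIntegers K)
    (v.adicCompletion K))).baseChange (AlgebraicClosure (v.adicCompletion K)))
  set X : AddSubgroup (geomPoints W) := geomTorsion W ((ℓ ^ m : ℕ) : ℤ) ⊓ S.comap Ψ with hX
  have hXle : X ≤ geomTorsion W ((ℓ ^ m : ℕ) : ℤ) := inf_le_left
  refine ⟨X, hXle, ?_, fun τ hτ P hP ↦ ?_⟩
  · -- `#X = #Ψ(X) ≤ ℓ ^ m`
    have hℓm0 : ((ℓ ^ m : ℕ) : ℤ) ≠ 0 := by exact_mod_cast pow_ne_zero m hℓ.out.ne_zero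
    haveI : Finite (geomTorsion W ((ℓ ^ m : ℕ) : ℤ)) :=
      finite_torsionPoints_holds W (AlgebraicClosure K) hℓm0
    haveI : Finite X := Finite.of_injective _ (AddSubgroup.inclusion_injective hXle)
    set G := X.map Ψ with hG
    have hGfin : (G : Set ((M.map (algebraMap (v.adicCompletionIntegers K)
        (v.adicCompletion K))).baseChange (AlgebraicClosure (v.adicCompletion K))).toAffine.Point).Finite := by
      rw [hG, AddSubgroup.coe_map]
      exact (Set.toFinite _).image Ψ
    haveI : Finite G := hGfin.to_subtype
    have hcard : Nat.card X = Nat.card G := Nat.card_congr (X.equivMapOfInjective Ψ hΨinj).toEquiv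
    rw [hcard]
    have hℓL : (ℓ : AlgebraicClosure (v.adicCompletion K)) ≠ 0 := by
      rw [← map_natCast (algebraMap K (AlgebraicClosure (v.adicCompletion K))) ℓ]
      exact (map_ne_zero_iff _ (algebraMap K _).injective).mpr (Nat.cast_ne_zero.mpr hℓ.out.ne_zero)
    have hAw : w (((M.map (algebraMap (v.adicCompletionIntegers K) (v.adicCompletion K))).baseChange
        (AlgebraicClosure (v.adicCompletion K))).hasseCoeff ℓ) = 1 := by
      rw [baseChange, map_hasseCoeff, map_hasseCoeff]
      exact spectralValuation_eq_one_of_isUnit hw hA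
    refine card_addSubgroup_le_pow_of_hasseCoeff w _ hℓ2 (spectralValuation_natCast_lt_one hw hℓv)
      hℓL hAw m G ?_ ?_
    · intro x y h hmem
      obtain ⟨Q, hQ, hQeq⟩ := AddSubgroup.mem_map.mp hmem
      have hQS : Ψ Q ∈ S := (AddSubgroup.mem_inf.mp hQ).2
      exact (hS _).mp hQS x y h hQeq
    · intro Q hmem
      obtain ⟨P, hP, rfl⟩ := AddSubgroup.mem_map.mp hmem
      have hP0 : ((ℓ ^ m : ℕ) : ℤ) • P = 0 :=
        (Submodule.mem_torsionBy_iff _ P).mp (AddSubgroup.mem_inf.mp hP).1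
      rw [← map_zsmul Ψ, hP0, map_zero]
  · -- `P^τ - P ∈ E[ℓ^m] ∩ Ψ⁻¹(E₁ ∪ {O})`
    refine AddSubgroup.mem_inf.mpr ⟨?_, ?_⟩
    · have hP0 : ((ℓ ^ m : ℕ) : ℤ) • P = 0 := (Submodule.mem_torsionBy_iff _ P).mp hP
      refine (Submodule.mem_torsionBy_iff _ _).mpr ?_
      rw [smul_sub, smul_comm, hP0, smul_zero, sub_self]
    · rw [AddSubgroup.mem_comap, hS]
      intro x y h hxy
      exact hΨ τ hτ hΔ P x y h hxy

end NumberField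

end Summit.Langlands.Langlands.Theorems.FiveIsogenyEllipticCurves

end
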